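import Summits.Ventures.LatticeQCDFlow.Scaling.SpecialUnitarySmallBall
import Summits.Ventures.LatticeQCDFlow.Scaling.TunnellingLaws

/-!
# LatticeQCDFlow / Scaling — local paths on `SU(N)^E` at small scale, and the metric small-step tunnelling law for `SU(N)` charges

HONEST FRAMING: exact (Metropolis-corrected) sampling algorithms for lattice gauge theory; figures of merit are
autocorrelation/cost numbers at stated couplings and volumes; no continuum-physics claim.

Venture `LatticeQCDFlow` (cell pub-lqcd), topic `Scaling`, FANOUT row 30 (lean-1) — OUR WORK, the first of the two
named inputs of THEORY-2 v3.1 conjecture C7(a) ("local paths on `SU(N)` in the tree's configuration metric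
(linkwise geodesics; lean-1-sized)", `Scaling/MetricTunnelling.lean`), at SMALL SCALE and with constant ONE:

* §1 `re_trace_mul_le` — the Hilbert–Schmidt AM–GM bound `Re tr(R X) ≤ ‖R‖²/(2a) + a‖X‖²/2` (`a > 0`);
* §2 **`norm_exp_smul_sub_one_le`** — RADIAL MONOTONICITY of the exponential chart: there is `δ > 0` (`N`-dependent
  only) such that for every traceless skew-Hermitian `X` with `‖X‖ ≤ δ` and every `t ∈ [0, 1]`,
  `‖exp(tX) - 1‖ ≤ ‖exp X - 1‖`.  Proof without spectral theory: `G(t) = Re tr exp(tX)` has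
  `G'(t) = Re tr(exp(tX)·X) = -t‖X‖² + Re tr(R_t X)` with `R_t = exp(tX) - 1 - tX`, `‖R_t‖ ≤ t‖X‖/2`
  (strict differentiability of `exp` at `0`, `SUN.exp_sub_exp_approx`), so `G' ≤ 0` by §1 and `G` is antitone;
* §3 **`SUN.exists_localPath`** — every two `U, V ∈ SU(N)` with `dist U V ≤ r₀` (`r₀ > 0` depending on `N` only)
  are joined by a continuous path `γ` (`γ t = U·suChart(t•a)`, the one-parameter subgroup through `U⁻¹V`, from
  `suChart_fill`) with `dist (γ t) U ≤ dist U V` for all `t ∈ [0,1]`; **`SUN.exists_localPath_config`** — the same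
  for configurations `SU(N)^E` in the sup metric (linkwise paths);
* §4 **`SUN.small_step_tunnelling`** — the METRIC SMALL-STEP TUNNELLING LAW on `SU(N)^E`: for every
  integer charge `Q` continuous off a defect set `D`, every s-finite `μ` and `μ`-invariant Markov
  kernel with a.s. moves of length `≤ ρ ≤ r₀`: `(μ ⊗ₘ κ){Q ≠ Q'} ≤ 2·μ(cthickening ρ D)` (theory-2's engine
  `Tunnelling.compProd_chargeChange_le_of_invariant` + the local separating lemma
  `mem_cthickening_of_dist_le_of_ne_local`).  The second named input — Lüscher's sector theorem (an integer charge
  continuous off the non-admissible set) — stays a cited hypothesis (`hQ`), as in THEORY-2 v3.1.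

Elementary given the tree; nothing is cited as a fact.
-/

noncomputable section

open scoped Matrix.Norms.Frobenius Matrix NNReal
open MeasureTheory Metric Set Filter Topology NormedSpace ProbabilityTheory
open Literature.MathematicalPhysics.QuantumFieldTheory
open Literature.MathematicalPhysics.QuantumFieldTheory.UnitaryCayley (𝔼 skewOf skewOf_unskew conjTranspose_skewOf)

namespace Summit.Ventures.LatticeQCDFlow.Theory2.Lattice.SUN

variable {N : ℕ}

/-! ## §1. Two Hilbert–Schmidt identities -/

/-- **AM–GM for the Hilbert–Schmidt pairing**: `Re tr(R·X) ≤ ‖R‖²/(2a) + a·‖X‖²/2` for `a > 0`. [folklore] -/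
theorem re_trace_mul_le (R X : Matrix (Fin N) (Fin N) ℂ) {a : ℝ} (ha : 0 < a) :
    (R * X).trace.re ≤ ‖R‖ ^ 2 / (2 * a) + a * ‖X‖ ^ 2 / 2 := by
  -- `0 ≤ ‖Rᴴ - aX‖² = ‖R‖² + a²‖X‖² - 2a·Re tr(R X)`
  have h0 : 0 ≤ ‖Rᴴ - (a : ℂ) • X‖ ^ 2 := sq_nonneg _
  have hexp : ‖Rᴴ - (a : ℂ) • X‖ ^ 2 = ‖R‖ ^ 2 + a ^ 2 * ‖X‖ ^ 2 - 2 * a * (R * X).trace.re := by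
    rw [Matrix.frobenius_norm_sq_eq_re_trace, Matrix.frobenius_norm_sq_eq_re_trace R,
      Matrix.frobenius_norm_sq_eq_re_trace X]
    rw [Matrix.conjTranspose_sub, Matrix.conjTranspose_smul, Matrix.conjTranspose_conjTranspose,
      Matrix.sub_mul, Matrix.mul_sub, Matrix.mul_sub, Matrix.smul_mul, Matrix.mul_smul, Matrix.mul_smul,
      Matrix.smul_mul, smul_smul]
    simp only [Matrix.trace_sub, Matrix.trace_smul, smul_eq_mul, map_sub, RCLike.star_def,
      Complex.conj_ofReal]
    have h1 : ((a : ℂ) * (Xᴴ * R.conjTranspose).trace).re = a * (R * X).trace.re := by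
      rw [Complex.re_ofReal_mul, ← Matrix.conjTranspose_mul, Matrix.trace_conjTranspose, Complex.star_def,
        Complex.conj_re]
    have h2 : ((a : ℂ) * (R * X).trace).re = a * (R * X).trace.re := Complex.re_ofReal_mul _ _
    have h3 : ((a : ℂ) * (a : ℂ) * (Xᴴ * X).trace).re = a ^ 2 * (Xᴴ * X).trace.re := by
      rw [← Complex.ofReal_mul, Complex.re_ofReal_mul]; ring
    have h4 : (R * R.conjTranspose).trace.re = (Rᴴ * R).trace.re := by rw [Matrix.trace_mul_comm]
    simp only [RCLike.re_to_complex]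
    rw [h1, h2, h3, h4]
    ring
  rw [hexp] at h0
  have h2a : 0 < 2 * a := by linarith
  rw [div_add_div _ _ h2a.ne' two_ne_zero, le_div_iff₀ (by positivity)]
  nlinarith

/-! ## §2. Radial monotonicity of the exponential chart at small scale -/

/-- **Radial monotonicity**: there is `δ > 0` such that for every skew-Hermitian `X` with `‖X‖ ≤ δ` and every
`t ∈ [0,1]`, `‖exp(tX) - 1‖ ≤ ‖exp X - 1‖`. [folklore] -/
theorem norm_exp_smul_sub_one_le : ∃ δ : ℝ, 0 < δ ∧ ∀ X : Matrix (Fin N) (Fin N) ℂ, Xᴴ = -X → ‖X‖ ≤ δ →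
    ∀ t ∈ Icc (0 : ℝ) 1, ‖exp (t • X) - 1‖ ≤ ‖exp X - 1‖ := by
  obtain ⟨δ₀, hδ₀, hap⟩ := exp_sub_exp_approx (N := N) (c := 1 / 2) (by norm_num)
  refine ⟨δ₀ / 2, by positivity, fun X hX hXδ t ht => ?_⟩
  -- `‖W - 1‖² = 2·(N - Re tr W)` for unitary `W` (the tree's `UN.action_eq`)
  have hnorm : ∀ {W : Matrix (Fin N) (Fin N) ℂ}, W ∈ Matrix.unitaryGroup (Fin N) ℂ →
      ‖W - 1‖ ^ 2 = 2 * ((N : ℝ) - W.trace.re) := by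
    intro W hW
    have h := UN.action_eq (⟨W, hW⟩ : UnitaryCayley.𝔾 N)
    rw [Literature.MathematicalPhysics.QuantumLattice.unitaryFundamentalRep_apply] at h
    change (N : ℝ) - W.trace.re = ‖W - 1‖ ^ 2 / 2 at h
    linarith
  -- unitarity of `exp (s • X)`
  have hunit : ∀ s : ℝ, exp (s • X) ∈ Matrix.unitaryGroup (Fin N) ℂ := fun s =>
    exp_mem_unitary_of_mem_skewAdjoint (by
      rw [skewAdjoint.mem_iff, star_smul, star_trivial, Matrix.star_eq_conjTranspose, hX, smul_neg])
  -- the remainder bound `‖exp(sX) − 1 − sX‖ ≤ (1/2)·‖sX‖` for `s ∈ [0,1]`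
  have hrem : ∀ s ∈ Icc (0 : ℝ) 1, ‖exp (s • X) - 1 - s • X‖ ≤ 1 / 2 * (s * ‖X‖) := by
    intro s hs
    have hsX : ‖s • X‖ < δ₀ := by
      rw [norm_smul, Real.norm_eq_abs, abs_of_nonneg hs.1]
      calc s * ‖X‖ ≤ 1 * (δ₀ / 2) := mul_le_mul hs.2 hXδ (norm_nonneg _) zero_le_one
        _ < δ₀ := by linarith
    have h := hap (s • X) 0 hsX (by rw [norm_zero]; exact hδ₀)
    rw [exp_zero, sub_zero, norm_smul, Real.norm_eq_abs, abs_of_nonneg hs.1] at h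
    exact h
  -- `G(s) = Re tr exp(sX)` and its derivative
  set L : Matrix (Fin N) (Fin N) ℂ →L[ℝ] ℝ :=
    (Complex.reCLM.toLinearMap.comp ((Matrix.traceLinearMap (Fin N) ℂ ℂ).restrictScalars ℝ)).toContinuousLinearMap
    with hL
  have hLapply : ∀ M : Matrix (Fin N) (Fin N) ℂ, L M = M.trace.re := fun M => rfl
  have hG : ∀ s, HasDerivAt (fun u : ℝ => (exp (u • X)).trace.re) ((exp (s • X) * X).trace.re) s := by
    intro s
    have h := L.hasFDerivAt.comp_hasDerivAt s (hasDerivAt_exp_smul_const (𝕂 := ℝ) X s)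
    simp only [Function.comp_def, hLapply] at h
    exact h
  -- sign of the derivative on `(0, 1)`
  have hXX : (X * X).trace.re = -‖X‖ ^ 2 := by
    rw [Matrix.frobenius_norm_sq_eq_re_trace, hX, Matrix.neg_mul, Matrix.trace_neg, map_neg,
      RCLike.re_eq_complex_re, neg_neg]
  have hderiv : ∀ s ∈ interior (Icc (0 : ℝ) 1), (exp (s • X) * X).trace.re ≤ 0 := by
    intro s hs
    rw [interior_Icc] at hs
    have hs0 : 0 < s := hs.1
    set R := exp (s • X) - 1 - s • X with hR
    have hsplit : exp (s • X) * X = s • (X * X) + X + R * X := by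
      rw [hR, Matrix.sub_mul, Matrix.sub_mul, Matrix.one_mul, Matrix.smul_mul]; abel
    have htrX : X.trace.re = 0 := by
      have h1 : (Xᴴ).trace = (-X).trace := by rw [hX]
      rw [Matrix.trace_conjTranspose, Matrix.trace_neg, Complex.star_def] at h1
      have h2 := congrArg Complex.re h1
      rw [Complex.conj_re, Complex.neg_re] at h2
      linarith
    rw [hsplit, Matrix.trace_add, Matrix.trace_add, Matrix.trace_smul, Complex.add_re, Complex.add_re,
      Complex.smul_re, hXX, htrX, smul_eq_mul]
    have hRX := re_trace_mul_le R X (a := s / 2) (by positivity)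
    have hRn : ‖R‖ ≤ 1 / 2 * (s * ‖X‖) := hrem s ⟨hs0.le, hs.2.le⟩
    have hRn2 : ‖R‖ ^ 2 ≤ (1 / 2 * (s * ‖X‖)) ^ 2 := pow_le_pow_left₀ (norm_nonneg _) hRn 2
    have h3 : ‖R‖ ^ 2 / (2 * (s / 2)) ≤ s * ‖X‖ ^ 2 / 4 := by
      rw [show 2 * (s / 2) = s by ring, div_le_iff₀ hs0]
      nlinarith [norm_nonneg X]
    nlinarith [norm_nonneg X, sq_nonneg ‖X‖]
  -- `G` is antitone on `[0, 1]`
  have hanti : AntitoneOn (fun u : ℝ => (exp (u • X)).trace.re) (Icc 0 1) := by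
    refine antitoneOn_of_deriv_nonpos (convex_Icc 0 1) ?_ ?_ ?_
    · exact fun u _ => (hG u).continuousAt.continuousWithinAt
    · exact fun u _ => (hG u).differentiableAt.differentiableWithinAt
    · intro u hu
      rw [(hG u).deriv]
      exact hderiv u hu
  have hle : (exp ((1 : ℝ) • X)).trace.re ≤ (exp (t • X)).trace.re :=
    hanti ht (right_mem_Icc.2 zero_le_one) ht.2
  rw [one_smul] at hle
  have h1 := hnorm (hunit t)
  have h2 := hnorm (W := exp X) (by simpa using hunit 1)
  nlinarith [norm_nonneg (exp (t • X) - 1), norm_nonneg (exp X - 1)]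

/-! ## §3. Local paths on `SU(N)` and on `SU(N)^E` -/

/-- `dist (U⁻¹V) 1 = dist U V` (left invariance of the Hilbert–Schmidt distance). [folklore] -/
theorem dist_inv_mul_one (U V : Matrix.specialUnitaryGroup (Fin N) ℂ) : dist (U⁻¹ * V) 1 = dist U V := by
  have hU : (U : Matrix (Fin N) (Fin N) ℂ) ∈ Matrix.unitaryGroup (Fin N) ℂ :=
    (Matrix.mem_specialUnitaryGroup_iff.mp U.2).1
  have hUU : star (U : Matrix (Fin N) (Fin N) ℂ) * U = 1 := Matrix.mem_unitaryGroup_iff'.mp hU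
  have hsU : star (U : Matrix (Fin N) (Fin N) ℂ) ∈ Matrix.unitaryGroup (Fin N) ℂ := by
    rw [Matrix.mem_unitaryGroup_iff, star_star]; exact hUU
  rw [Subtype.dist_eq, Subtype.dist_eq, dist_eq_norm, dist_eq_norm]
  have e : ((U⁻¹ * V : Matrix.specialUnitaryGroup (Fin N) ℂ) : Matrix (Fin N) (Fin N) ℂ) -
      ((1 : Matrix.specialUnitaryGroup (Fin N) ℂ) : Matrix (Fin N) (Fin N) ℂ) =
      ((⟨star (U : Matrix (Fin N) (Fin N) ℂ), hsU⟩ : Matrix.unitaryGroup (Fin N) ℂ) : Matrix (Fin N) (Fin N) ℂ) *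
        ((V : Matrix (Fin N) (Fin N) ℂ) - U) := by
    show star (U : Matrix (Fin N) (Fin N) ℂ) * (V : Matrix (Fin N) (Fin N) ℂ) - 1 =
      star (U : Matrix (Fin N) (Fin N) ℂ) * ((V : Matrix (Fin N) (Fin N) ℂ) - U)
    rw [Matrix.mul_sub, hUU]
  rw [e, Matrix.frobenius_norm_unitaryGroup_mul, norm_sub_rev]

/-- **Local paths on `SU(N)`** (Hilbert–Schmidt metric): there is `r₀ > 0` (depending on `N` only) such that any
`U, V` with `dist U V ≤ r₀` are joined by a continuous path `γ : [0,1] → SU(N)` — the one-parameter subgroup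
`t ↦ U·exp(tX)` through `U⁻¹V = exp X` — with `dist (γ t) U ≤ dist U V` throughout. [folklore] -/
theorem exists_localPath : ∃ r₀ : ℝ, 0 < r₀ ∧ ∀ U V : Matrix.specialUnitaryGroup (Fin N) ℂ, dist U V ≤ r₀ →
    ∃ γ : ℝ → Matrix.specialUnitaryGroup (Fin N) ℂ, ContinuousOn γ (Icc (0 : ℝ) 1) ∧ γ 0 = U ∧ γ 1 = V ∧
      ∀ t ∈ Icc (0 : ℝ) 1, dist (γ t) U ≤ dist U V := by
  obtain ⟨δ, hδ, hmono⟩ := norm_exp_smul_sub_one_le (N := N)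
  obtain ⟨r₁, hr₁, hfill⟩ := suChart_fill (N := N)
  refine ⟨min r₁ (δ / 2), lt_min hr₁ (by positivity), fun U V hUV => ?_⟩
  have hW : U⁻¹ * V ∈ closedBall (1 : Matrix.specialUnitaryGroup (Fin N) ℂ) (dist U V) := by
    rw [mem_closedBall, dist_inv_mul_one]
  obtain ⟨a, ha, haW⟩ := hfill (dist U V) dist_nonneg (hUV.trans (min_le_left _ _)) hW
  rw [mem_closedBall, dist_zero_right] at ha
  have hU : (U : Matrix (Fin N) (Fin N) ℂ) ∈ Matrix.unitaryGroup (Fin N) ℂ :=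
    (Matrix.mem_specialUnitaryGroup_iff.mp U.2).1
  -- the path
  refine ⟨fun t => U * suChart (t • a), ?_, ?_, ?_, fun t ht => ?_⟩
  · exact (continuous_const.mul (continuous_suChart.comp (continuous_id.smul continuous_const))).continuousOn
  · simp only [zero_smul, suChart_zero, mul_one]
  · show U * suChart ((1 : ℝ) • a) = V
    rw [one_smul, haW, mul_inv_cancel_left]
  · -- `dist (U·exp(tX)) U = ‖exp(tX) − 1‖ ≤ ‖exp X − 1‖ = dist U V`
    set X : Matrix (Fin N) (Fin N) ℂ := skewOf (a : 𝔼 N) with hXdef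
    have hXskew : Xᴴ = -X := conjTranspose_skewOf _
    have hXn : ‖X‖ ≤ δ := by
      rw [hXdef, LinearIsometry.norm_map, Submodule.norm_coe]
      linarith [hUV.trans (min_le_right r₁ (δ / 2))]
    have hdist : ∀ s : ℝ, dist (U * suChart (s • a)) U = ‖exp (s • X) - 1‖ := by
      intro s
      rw [Subtype.dist_eq, dist_eq_norm]
      have e : ((U * suChart (s • a) : Matrix.specialUnitaryGroup (Fin N) ℂ) : Matrix (Fin N) (Fin N) ℂ) -
          (U : Matrix (Fin N) (Fin N) ℂ) =
          ((⟨(U : Matrix (Fin N) (Fin N) ℂ), hU⟩ : Matrix.unitaryGroup (Fin N) ℂ) : Matrix (Fin N) (Fin N) ℂ) *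
            (exp (s • X) - 1) := by
        show (U : Matrix (Fin N) (Fin N) ℂ) * exp (skewOf ((s • a : suAlg N) : 𝔼 N)) - U =
          (U : Matrix (Fin N) (Fin N) ℂ) * (exp (s • X) - 1)
        rw [Submodule.coe_smul, map_smul, Matrix.mul_sub, Matrix.mul_one]
      rw [e, Matrix.frobenius_norm_unitaryGroup_mul]
    have hV : dist U V = ‖exp X - 1‖ := by
      have h := hdist 1
      rw [one_smul, haW, mul_inv_cancel_left, dist_comm, one_smul] at h
      exact h
    rw [hdist t, hV]
    exact hmono X hXskew hXn t ht

/-- **Local paths on `SU(N)^E`** (sup metric; linkwise one-parameter subgroups). [folklore] -/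
theorem exists_localPath_config {E : Type*} [Fintype E] : ∃ r₀ : ℝ, 0 < r₀ ∧
    ∀ U V : E → Matrix.specialUnitaryGroup (Fin N) ℂ, dist U V ≤ r₀ →
      ∃ γ : ℝ → (E → Matrix.specialUnitaryGroup (Fin N) ℂ), ContinuousOn γ (Icc (0 : ℝ) 1) ∧ γ 0 = U ∧
        γ 1 = V ∧ ∀ t ∈ Icc (0 : ℝ) 1, dist (γ t) U ≤ dist U V := by
  obtain ⟨r₀, hr₀, hpath⟩ := exists_localPath (N := N)
  refine ⟨r₀, hr₀, fun U V hUV => ?_⟩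
  have hlink : ∀ e, dist (U e) (V e) ≤ r₀ := fun e => (dist_le_pi_dist U V e).trans hUV
  choose γ hγc hγ0 hγ1 hγd using fun e => hpath (U e) (V e) (hlink e)
  refine ⟨fun t e => γ e t, ?_, funext fun e => hγ0 e, funext fun e => hγ1 e, fun t ht => ?_⟩
  · exact continuousOn_pi.2 fun e => hγc e
  · exact (dist_pi_le_iff dist_nonneg).2 fun e => (hγd e t ht).trans (dist_le_pi_dist U V e)

/-! ## §4. The metric small-step tunnelling law on `SU(N)^E` -/

/-- **Local separating lemma**: with local paths at scale `r₀`, a charge `Q` into a discrete space continuous off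
`D`, and `ρ ≤ r₀`: a move of length `≤ ρ` that changes `Q` starts in `cthickening ρ D`. [folklore] -/
theorem mem_cthickening_of_dist_le_of_ne_local {Y : Type*} [PseudoMetricSpace Y] {ι : Type*}
    [TopologicalSpace ι] [DiscreteTopology ι] {D : Set Y} {Q : Y → ι} (hQ : ContinuousOn Q Dᶜ) {r₀ : ℝ}
    (hpath : ∀ x y : Y, dist x y ≤ r₀ → ∃ γ : ℝ → Y, ContinuousOn γ (Icc (0 : ℝ) 1) ∧ γ 0 = x ∧ γ 1 = y ∧
      ∀ t ∈ Icc (0 : ℝ) 1, dist (γ t) x ≤ dist x y)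
    {x y : Y} {ρ : ℝ} (hρ : ρ ≤ r₀) (hxy : dist x y ≤ ρ) (hne : Q x ≠ Q y) : x ∈ cthickening ρ D := by
  by_contra hx
  obtain ⟨γ, hγc, hγ0, hγ1, hγd⟩ := hpath x y (hxy.trans hρ)
  have hsub : γ '' Icc (0 : ℝ) 1 ⊆ Dᶜ := by
    rintro _ ⟨t, ht, rfl⟩ hD
    exact hx (mem_cthickening_of_dist_le x (γ t) ρ D hD (by rw [dist_comm]; exact (hγd t ht).trans hxy))
  have h := (isPreconnected_Icc.image γ hγc).constant (hQ.mono hsub) ⟨0, left_mem_Icc.2 zero_le_one, hγ0⟩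
    ⟨1, right_mem_Icc.2 zero_le_one, hγ1⟩
  exact hne h

/-- **The metric small-step tunnelling law on `SU(N)^E`** (OURS; theory-2 v3.1 C7(a) with its path input
discharged): there is `r₀ > 0` (depending on `N` only) such that for every volume, every defect set `D`, every
integer charge `Q` continuous off `D` (Lüscher's sector theorem supplies this for the geometric charge — a cited
hypothesis here), every s-finite `μ`, every `μ`-invariant Markov kernel `κ` with a.s. moves of length `≤ ρ ≤ r₀`:
`(μ ⊗ₘ κ){Q ≠ Q'} ≤ 2·μ(cthickening ρ D)`. [folklore] -/
theorem small_step_tunnelling {E : Type*} [Fintype E] : ∃ r₀ : ℝ, 0 < r₀ ∧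
    ∀ (D : Set (E → Matrix.specialUnitaryGroup (Fin N) ℂ)) (Q : (E → Matrix.specialUnitaryGroup (Fin N) ℂ) → ℤ),
      ContinuousOn Q Dᶜ →
      ∀ (μ : Measure (E → Matrix.specialUnitaryGroup (Fin N) ℂ)) [SFinite μ]
        (κ : Kernel (E → Matrix.specialUnitaryGroup (Fin N) ℂ) (E → Matrix.specialUnitaryGroup (Fin N) ℂ))
        [IsMarkovKernel κ], κ.Invariant μ → ∀ ρ : ℝ, ρ ≤ r₀ → (∀ᵐ p ∂(μ ⊗ₘ κ), dist p.1 p.2 ≤ ρ) →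
          (μ ⊗ₘ κ) {p | Q p.1 ≠ Q p.2} ≤ 2 * μ (cthickening ρ D) := by
  obtain ⟨r₀, hr₀, hpath⟩ := exists_localPath_config (N := N) (E := E)
  refine ⟨r₀, hr₀, fun D Q hQ μ _ κ _ hinv ρ hρ hstep => ?_⟩
  exact Tunnelling.compProd_chargeChange_le_of_invariant (R := fun x y => dist x y ≤ ρ)
    (fun _ _ hxy hne => Or.inl (mem_cthickening_of_dist_le_of_ne_local hQ hpath hρ hxy hne)) μ κ hinv hstep

end Summit.Ventures.LatticeQCDFlow.Theory2.Lattice.SUN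

end
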